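import Literature.IUT.HodgeArakelov.RealifiedPrimeStripSplitComponent
import Literature.AnabelianGeometry.AbsoluteAnabelian.MLFGaloisModelPairs
import Literature.AnabelianGeometry.AbsoluteAnabelian.MLFGaloisMonoAnalyticModel
import Literature.AnabelianGeometry.AbsoluteAnabelian.GaloisPadicLogInstance
import HarnessLib

/-!
# [IUTchII] Def 4.9 (iii), (vi)–(viii): the prime-strip record types are inhabited WITH A GENUINE GALOIS SIDE
# (NV-L6 genuine-model upgrade; abc-iut cell, layer L6, seat abc-iut-w4-d028 gen 3; PROOF-ONLY — no def / instance)

S. Mochizuki, *Inter-universal Teichmüller theory II*, kurims Dec-2020 manuscript, Def 4.9 (ii)–(iii) p. 155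
(«Write `‡G := Aut(‡A)` [so `‡G` is a profinite group isomorphic to `G_w`]. Then the `2l`-torsion subgroup
`μ_{2l}(‡A) ⊆ O^×(‡A)` … together with the images of the splittings … generate a submonoid `O^⊥(‡A) ⊆ O^▷(‡A)`»;
«the splitting arising from the definition of `O^{▶×μ}(‡A)` as a direct product»), (vi)–(viii) pp. 157–158; *I*, kurims
May-2020 manuscript, Ex 3.2 (iv) p. 71 (the split Frobenioid `C^⊢_v` at `v ∈ V^bad`: divisor monoid `ℕ · log_Φ(q̲_v)`,
so that `O^▷ = O^× · q̲_v^ℕ`). [claim: Mochizuki2012, status: disputed] — nothing here asserts a disputed claim or takes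
a side on [IUTchIII] Cor 3.12; a witness certifies CONSISTENCY of a typed interface, not correctness of anything.

WHAT IS UPGRADED. Every landed inhabitant of abc-iut-L6-t2's local datum `NonarchTriMuDatum` (abc-iut-L6-d7,
`KummerPrimeStripsNonVacuity` p406437: TRIVIAL action), of the `F^{⊩▶×μ}`-prime-strip groupoid `FVdashSplitTriMuPrimeStrip`
(abc-iut-w5-d087, `RealifiedPrimeStripSplitComponent` p416833: Galois group `Unit`) and of the record types
`FSplitTriMuPrimeStrip` / `FTimesMuPrimeStrip` / `FTriMuPrimeStrip` (abc-iut-w4-d028, `KummerPrimeStripsSplitNonVacuity`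
p418814: Galois group `Unit`) is DEGENERATE ON THE GALOIS SIDE. Here `‡G` is the GENUINE `Π_k` of abc-iut-L4-t1's
[AbsTopIII] Def 3.1 model data `D : ModelMLFGaloisData k K` (a topological group with a continuous surjection
`ε_k : Π_k ↠ Gal(k̄/k)`; e.g. `Gal(ℚ̄_p/ℚ_p)` itself via `ModelMLFGaloisData.galois` and `MLFClosure.padic p`), acting
through `ε_k` on the GENUINE unit group `𝒪_k̄^×` (`unitSubmonoid k K`, instance `unitSubmonoidAction`); the local monoid
is `O^▷(‡A) := 𝒪_k̄^× × q^ℕ` — print's split monoid `O^× · q̲^ℕ` as «a direct product» — with `Π_k` acting on the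
first factor, splitting `q^ℕ`, genuine torsion `μ_{2l}(𝒪_k̄^×)`, `O^⊥/μ_{2l} = O^▷/O^×` PROVED
(`OPerpPresentsAssociates_of_bijective`), open subgroups := the open subgroups of `Π_k`, valuation `ρ(u, q^n) = n`,
generator `q` with `ρ(q) = 1`, pilot object of degree `−1`.

HONEST RESIDUAL (unchanged from every earlier witness, stated in the theorems): the `×`/`×μ`-Kummer structures are
the TAUTOLOGICAL ones of `KummerPrimeStripsNonVacuity` — «group-theoretic units» `O^×(G) := O^×(‡A)` itself with
`Im(Ẑ^×) := 1`; the genuine `O^×(G)` is the [AbsTopIII] Cor 1.10 reconstruction plus cyclotomic rigidity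
(MERGE-MAP row B9), not modelled here. The statements below are ∃-forms WITH DEFINING EQUATIONS (`ι : O^×(G) ↪ k̄` with
range `𝒪_k̄^×` and `ι(g · u) = ε_k(g) · ι(u)`; `e : O^▷ ≃ 𝒪_k̄^× × q^ℕ` with the action and splitting read through
`e`), so that the genuine content is visible in the kernel, not only a bare `Nonempty`.

* §1 `exists_strip_of_datum` — generic: ANY bad-place datum `T` with a valuation `ν : O^▷ → ℕ` and an element `q`,
  `ν(q) = 1`, is the local datum of an `F^{⊩▶×μ}`-prime-strip over one bad place (realified Frobenioid `realLine` of
  p416833, `ρ := ν` realified, pilot `−1`).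
* §2 `NonarchTriMuDatum.exists_galois` — the genuine-Galois local datum, every `l`, every nonarchimedean place type.
* §3 `exists_galois`, `FSplitTriMuPrimeStrip.nonempty_galois`, `FTimesMuPrimeStrip.nonempty_galois`,
  `FTriMuPrimeStrip.nonempty_galois` — the strip and the three record types over `(fun _ => D.Pi)`;
  `mapAut_toTimesMu_surjective_galois` — [IUTchIII] Thm 2.2 (i) at the genuine-Galois strip; `nonempty_galois_padic` —
  the closed instance `‡G = Gal(ℚ̄_p/ℚ_p)`.
-/

noncomputable section

namespace Literature.IUT.HodgeArakelov

open CategoryTheory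
open Literature.AnabelianGeometry.AbsoluteAnabelian
open scoped NNReal

namespace FVdashSplitTriMuPrimeStrip

namespace GaloisWitness

/-! ### §1 From a bad-place local datum with an `ℕ`-valued valuation to an `F^{⊩▶×μ}`-prime-strip -/

/-- **IUTchII:Def4.9(viii)** (kurims p.158) GENERIC STRIP ASSEMBLY over one bad place: a local datum `T = ‡F^{⊢▶×μ}_w`
([IUTchII] Def 4.9 (iii)) over ANY `‡G`, together with a monoid homomorphism `ν : O^▷(‡A) → ℕ` and an element `q` with
`ν(q) = 1` («the generators of the monoids `O^▶(−)` [each of which is abstractly isomorphic to `ℕ`]»), is the local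
datum of an `F^{⊩▶×μ}`-prime-strip over the place data `badOnly l`: `ρ := ν` descended to `O^▶ = O^▷/O^×` (units have
`ν = 0`) and realified, generator the class of `q`, global realified Frobenioid `realLine` (p416833), pilot object of
degree `−1 = −ρ(q)`. [cite: Mochizuki2012, Def 4.9 (viii) p.158] -/
theorem exists_strip_of_datum {G : Type} [Group G] {X : GroupTheoreticUnits.{0, 0} G} (l : ℕ)
    (T : NonarchTriMuDatum.{0, 0, 0} l PlaceKind.bad G X) (ν : (T.O : Type) →* Multiplicative ℕ) (q : T.O)
    (hq : ν q = Multiplicative.ofAdd 1) :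
    ∃ S : FVdashSplitTriMuPrimeStrip.{0, 0, 0} (Witness.badOnly l) (fun _ => G) (fun _ => X),
      S.data.strip.localDatum () = LocalTriMuDatum.bad T ∧
      S.data.realifiedF.deg S.data.pilot = -1 ∧
      (∀ h : (Witness.badOnly l).kind () = PlaceKind.bad,
        Multiplicative.toAdd (S.data.rho () (S.data.triGen () h)) = 1) := by
  -- units of `O^▷` have valuation `0`
  have hunit : ∀ c : (T.O : Type)ˣ, ν (c : T.O) = 1 := by
    intro c
    have h : ν (c : T.O) * ν (↑c⁻¹ : T.O) = 1 := by rw [← map_mul, Units.mul_inv, map_one]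
    have h' : Multiplicative.toAdd (ν (c : T.O)) + Multiplicative.toAdd (ν (↑c⁻¹ : T.O)) = 0 := by
      rw [← toAdd_mul, h, toAdd_one]
    apply Multiplicative.toAdd.injective
    rw [toAdd_one]
    omega
  -- `ν` descended to `O^▶ = O^▷/O^×`
  let trival : OTri T.O →* Multiplicative ℕ :=
    { toFun := fun a => Quotient.liftOn a (fun x => ν x) (fun x y (h : Associated x y) => by
        obtain ⟨c, rfl⟩ := h
        show ν x = ν (x * c)
        rw [map_mul, hunit, mul_one])
      map_one' := by
        show ν 1 = 1
        exact map_one _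
      map_mul' := fun a b => Quotient.inductionOn₂ a b fun x y => by
        show ν (x * y) = ν x * ν y
        exact map_mul _ _ _ }
  have trival_mk : ∀ x : T.O, trival (Associates.mk x) = ν x := fun _ => rfl
  let rho : OTri T.O →* Multiplicative ℝ≥0 := Witness.castHom.comp trival
  have rho_q : rho (toOTri _ q) = Multiplicative.ofAdd (1 : ℝ≥0) := by
    show Witness.castHom (trival (Associates.mk q)) = _
    rw [trival_mk, hq]
    exact congrArg Multiplicative.ofAdd Nat.cast_one
  refine ⟨⟨{ realifiedF := Witness.realLine
             strip := ⟨fun _ => LocalTriMuDatum.bad T⟩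
             rho := fun _ => rho
             triGen := fun _ _ => toOTri _ q
             rho_triGen_pos := fun _ _ => ?_
             pilot := (-1 : ℝ)
             pilot_localDeg_bad := fun _ _ => ?_
             pilot_localDeg_other := fun _ h => (h rfl).elim }⟩, rfl, rfl, fun _ => ?_⟩
  · show 0 < Multiplicative.toAdd (rho (toOTri _ q))
    rw [rho_q, toAdd_ofAdd]; exact one_pos
  · show (-1 : ℝ) = -((Multiplicative.toAdd (rho (toOTri _ q)) : ℝ≥0) : ℝ)
    rw [rho_q, toAdd_ofAdd, NNReal.coe_one]
  · show Multiplicative.toAdd (rho (toOTri _ q)) = 1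
    rw [rho_q, toAdd_ofAdd]

/-! ### §2 The genuine-Galois local datum `‡F^{⊢▶×μ}_w`: `Π_k ↷ 𝒪_k̄^× × q^ℕ` -/

variable {k : Type} [Field k] [ValuativeRel k] {K : Type} [Field K] [Algebra k K]
  (D : ModelMLFGaloisData.{0} k K)

/-- **IUTchII:Def4.9(iii)** (kurims p.155) / (iv) (p.156) GENUINE-GALOIS local datum `‡F^{⊢▶×μ}_w`, for every `l` and
every nonarchimedean place type: `‡G := Π_k` of the [AbsTopIII] Def 3.1 model data `D` (`ε_k : Π_k ↠ Gal(k̄/k)`),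
`O^▷(‡A) := 𝒪_k̄^× × q^ℕ` (print's «direct product» split monoid `O^× · q̲^ℕ`, [IUTchI] Ex 3.2 (iv)) with `Π_k` acting
through `ε_k` on `𝒪_k̄^×` and trivially on `q^ℕ`, splitting `q^ℕ`, the presentation `O^⊥/μ_{2l} = O^▷/O^×` PROVED; the
«group-theoretic units» `O^×(G)` are identified — by the injection `ι` into `k̄` — with `𝒪_k̄^×` carrying the action
`ι(g · u) = ε_k(g) · ι(u)`, open subgroups = the open subgroups of `Π_k`, `Im(Ẑ^×) := 1` and the Kummer structures
TAUTOLOGICAL (honest residual). All defining equations are part of the statement. [cite: Mochizuki2012, Def 4.9 (iii) p.155] -/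
theorem _root_.Literature.IUT.HodgeArakelov.NonarchTriMuDatum.exists_galois (l : ℕ) (kd : PlaceKind) :
    ∃ (X : GroupTheoreticUnits.{0, 0} D.Pi) (T : NonarchTriMuDatum.{0, 0, 0} l kd D.Pi X)
      (e : (T.O : Type) ≃* ↥(unitSubmonoid k K) × Multiplicative ℕ) (ι : X.OxG →* K),
      X.openSubgroups = {H : Subgroup D.Pi | IsOpen (H : Set D.Pi)} ∧ X.zhatUnits = ⊥ ∧
      Function.Injective ι ∧ Set.range ι = ↑(unitSubmonoid k K) ∧
      (∀ (g : D.Pi) (u : X.OxG), ι (X.act g u) = D.aug g • ι u) ∧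
      (∀ (g : D.Pi) (x : T.O), e (T.act g x) = (g • (e x).1, (e x).2)) ∧
      (∀ x : T.O, x ∈ T.splitting ↔ (e x).1 = 1) := by
  classical
  -- every element of `𝒪_k̄^×` is a unit of that monoid
  have hunitU : ∀ u : ↥(unitSubmonoid k K), IsUnit u := by
    intro u
    obtain ⟨hx, y, hy, hxy⟩ := u.2
    refine ⟨⟨u, ⟨y, hy, u, hx, by rw [mul_comm]; exact hxy⟩, Subtype.ext hxy,
      Subtype.ext (by rw [Submonoid.coe_mul, mul_comm]; exact hxy)⟩, rfl⟩
  -- the product monoid `𝒪_k̄^× × q^ℕ` with `Π_k` acting on the first factor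
  let actU : D.Pi →* MulAut ↥(unitSubmonoid k K) := MulDistribMulAction.toMulAut D.Pi ↥(unitSubmonoid k K)
  let act : D.Pi →* MulAut (↥(unitSubmonoid k K) × Multiplicative ℕ) :=
    { toFun := fun g => MulEquiv.prodCongr (actU g) (MulEquiv.refl _)
      map_one' := by
        apply MulEquiv.ext
        intro x
        show ((actU 1) x.1, x.2) = x
        rw [map_one]
        rfl
      map_mul' := fun g h => by
        apply MulEquiv.ext
        intro x
        show ((actU (g * h)) x.1, x.2) = ((actU g) ((actU h) x.1), x.2)
        rw [map_mul]
        rfl }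
  have act_apply : ∀ (g : D.Pi) (x : ↥(unitSubmonoid k K) × Multiplicative ℕ), act g x = (g • x.1, x.2) :=
    fun _ _ => rfl
  let M : CoveringMonoid.{0, 0} D.Pi := ⟨CommMonCat.of (↥(unitSubmonoid k K) × Multiplicative ℕ), act⟩
  let opens : Set (Subgroup D.Pi) := {H : Subgroup D.Pi | IsOpen (H : Set D.Pi)}
  let X : GroupTheoreticUnits.{0, 0} D.Pi :=
    { OxG := M.Oˣ, act := M.unitsAct, openSubgroups := opens, zhatUnits := ⊥,
      zhatUnits_comm := fun γ hγ g => by rw [Subgroup.mem_bot.mp hγ, one_mul, mul_one] }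
  obtain ⟨κ⟩ := nonempty_kummerTimes_tautological D.Pi M opens
  obtain ⟨κμ⟩ := nonempty_kummerTimesMu_tautological D.Pi M opens
  -- units of the product have trivial `q`-component
  have hsnd : ∀ w : (↥(unitSubmonoid k K) × Multiplicative ℕ)ˣ, (w : ↥(unitSubmonoid k K) × Multiplicative ℕ).2 = 1 := by
    intro w
    have h := congrArg Prod.snd w.mul_inv
    rw [Prod.snd_mul, Prod.snd_one] at h
    have h' := congrArg Multiplicative.toAdd h
    rw [toAdd_mul, toAdd_one] at h'
    apply Multiplicative.toAdd.injective
    rw [toAdd_one]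
    omega
  -- the generator `q` and the splitting `q^ℕ`, which maps bijectively onto `O^▷/O^×`
  let q : ↥(unitSubmonoid k K) × Multiplicative ℕ := (1, Multiplicative.ofAdd 1)
  have q_pow : ∀ n : ℕ, q ^ n = (1, Multiplicative.ofAdd n) := by
    intro n
    refine Prod.ext ?_ ?_
    · rw [Prod.pow_fst, one_pow]
    · rw [Prod.pow_snd, ← ofAdd_nsmul, smul_eq_mul, mul_one]
  have assoc_q : ∀ x : ↥(unitSubmonoid k K) × Multiplicative ℕ,
      Associated (q ^ Multiplicative.toAdd x.2) x := by
    intro x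
    obtain ⟨c, hc⟩ := hunitU x.1
    refine ⟨Units.map (MonoidHom.inl _ (Multiplicative ℕ)) c, Prod.ext ?_ ?_⟩
    · rw [Prod.fst_mul, q_pow]
      show 1 * (c : ↥(unitSubmonoid k K)) = x.1
      rw [one_mul, hc]
    · rw [Prod.snd_mul, q_pow]
      show Multiplicative.ofAdd (Multiplicative.toAdd x.2) * 1 = x.2
      rw [mul_one, ofAdd_toAdd]
  have hbij : Function.Bijective fun s : Submonoid.powers q =>
      Associates.mk (s : ↥(unitSubmonoid k K) × Multiplicative ℕ) := by
    constructor
    · rintro ⟨s, hs⟩ ⟨t, ht⟩ hst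
      obtain ⟨m, rfl⟩ := (Submonoid.mem_powers_iff _ _).mp hs
      obtain ⟨n, rfl⟩ := (Submonoid.mem_powers_iff _ _).mp ht
      obtain ⟨c, hc⟩ := Associates.mk_eq_mk_iff_associated.mp hst
      have h2 : (q ^ m * (c : ↥(unitSubmonoid k K) × Multiplicative ℕ)).2 = (q ^ n).2 :=
        congrArg Prod.snd hc
      rw [Prod.snd_mul, hsnd c, mul_one, q_pow, q_pow] at h2
      have hmn : m = n := Multiplicative.ofAdd.injective h2
      subst hmn
      rfl
    · intro a
      obtain ⟨x, rfl⟩ := Associates.mk_surjective a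
      exact ⟨⟨q ^ Multiplicative.toAdd x.2, (Submonoid.mem_powers_iff _ _).mpr ⟨_, rfl⟩⟩,
        Associates.mk_eq_mk_iff_associated.mpr (assoc_q x)⟩
  let T : NonarchTriMuDatum.{0, 0, 0} l kd D.Pi X :=
    ⟨CommMonCat.of (↥(unitSubmonoid k K) × Multiplicative ℕ), act, Submonoid.powers q,
      OPerpPresentsAssociates_of_bijective (torsionOrder l kd) _ hbij, κ, κμ⟩
  let ι : X.OxG →* K :=
    ((unitSubmonoid k K).subtype.comp (MonoidHom.fst _ (Multiplicative ℕ))).comp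
      (Units.coeHom (↥(unitSubmonoid k K) × Multiplicative ℕ))
  have ι_apply : ∀ w : X.OxG,
      ι w = (((w : (↥(unitSubmonoid k K) × Multiplicative ℕ)ˣ) : ↥(unitSubmonoid k K) × Multiplicative ℕ).1 : K) :=
    fun _ => rfl
  refine ⟨X, T, MulEquiv.refl _, ι, rfl, rfl, ?_, ?_, ?_, fun g x => act_apply g x, fun x => ?_⟩
  · -- `ι` is injective
    intro w w' h
    rw [ι_apply, ι_apply] at h
    exact Units.ext (Prod.ext (Subtype.ext h) (by rw [hsnd, hsnd]))
  · -- the range of `ι` is `𝒪_k̄^×`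
    ext x
    constructor
    · rintro ⟨w, rfl⟩
      rw [ι_apply]
      exact Subtype.coe_prop _
    · intro hx
      obtain ⟨c, hc⟩ := hunitU ⟨x, hx⟩
      refine ⟨Units.map (MonoidHom.inl _ (Multiplicative ℕ)) c, ?_⟩
      rw [ι_apply]
      show (((c : ↥(unitSubmonoid k K)), (1 : Multiplicative ℕ)).1 : K) = x
      rw [hc]
  · -- `ι` is `Π_k`-equivariant through `ε_k`
    intro g w
    rfl
  · -- the splitting is `q^ℕ = {x | x.1 = 1}`
    show x ∈ Submonoid.powers q ↔ x.1 = 1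
    rw [Submonoid.mem_powers_iff]
    constructor
    · rintro ⟨n, rfl⟩
      rw [q_pow]
    · intro hx
      exact ⟨Multiplicative.toAdd x.2, by rw [q_pow]; exact Prod.ext hx.symm (ofAdd_toAdd _)⟩

/-! ### §3 The genuine-Galois `F^{⊩▶×μ}`-prime-strip and the record types it inhabits -/

/-- **IUTchII:Def4.9(viii)** (kurims p.158) GENUINE-GALOIS `F^{⊩▶×μ}`-prime-strip over ONE bad place: for every `l`
and every [AbsTopIII] Def 3.1 model data `D` (`ε_k : Π_k ↠ Gal(k̄/k)`), the print-level groupoid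
`FVdashSplitTriMuPrimeStrip (badOnly l) (fun _ => Π_k) X` is INHABITED by a strip whose local datum is the
genuine-Galois `‡F^{⊢▶×μ}_w` of `NonarchTriMuDatum.exists_galois` (`Π_k ↷ 𝒪_k̄^× × q^ℕ` through `ε_k`, splitting
`q^ℕ`, group-theoretic units `≅ 𝒪_k̄^× ⊆ k̄` equivariantly, open subgroups of `Π_k`; Kummer structures tautological,
`Im(Ẑ^×) := 1`), with `ρ(u, q^n) = n`, generator `q`, `ρ(q) = 1`, pilot object of degree `−1` — defining equations
in the statement. [cite: Mochizuki2012, Def 4.9 (viii) p.158] -/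
theorem exists_galois (l : ℕ) :
    ∃ (X : Unit → GroupTheoreticUnits.{0, 0} D.Pi)
      (T : NonarchTriMuDatum.{0, 0, 0} l PlaceKind.bad D.Pi (X ()))
      (S : FVdashSplitTriMuPrimeStrip.{0, 0, 0} (Witness.badOnly l) (fun _ => D.Pi) X)
      (e : (T.O : Type) ≃* ↥(unitSubmonoid k K) × Multiplicative ℕ) (ι : (X ()).OxG →* K),
      S.data.strip.localDatum () = LocalTriMuDatum.bad T ∧
      S.data.realifiedF.deg S.data.pilot = -1 ∧
      (∀ h : (Witness.badOnly l).kind () = PlaceKind.bad,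
        Multiplicative.toAdd (S.data.rho () (S.data.triGen () h)) = 1) ∧
      (X ()).openSubgroups = {H : Subgroup D.Pi | IsOpen (H : Set D.Pi)} ∧ (X ()).zhatUnits = ⊥ ∧
      Function.Injective ι ∧ Set.range ι = ↑(unitSubmonoid k K) ∧
      (∀ (g : D.Pi) (u : (X ()).OxG), ι ((X ()).act g u) = D.aug g • ι u) ∧
      (∀ (g : D.Pi) (x : T.O), e (T.act g x) = (g • (e x).1, (e x).2)) ∧
      (∀ x : T.O, x ∈ T.splitting ↔ (e x).1 = 1) := by
  obtain ⟨X, T, e, ι, hop, hz, hinj, hran, hιact, hact, hspl⟩ := NonarchTriMuDatum.exists_galois D l PlaceKind.bad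
  -- the valuation `ν(u, q^n) = n` read through `e`, and the generator `q = e⁻¹ (1, 1)`
  let ν : (T.O : Type) →* Multiplicative ℕ := (MonoidHom.snd _ _).comp e.toMonoidHom
  let q : T.O := e.symm (1, Multiplicative.ofAdd 1)
  have hq : ν q = Multiplicative.ofAdd 1 := by
    show (e (e.symm (1, Multiplicative.ofAdd 1))).2 = Multiplicative.ofAdd 1
    rw [MulEquiv.apply_symm_apply]
  obtain ⟨S, hS, hdeg, hrho⟩ := exists_strip_of_datum (X := X) l T ν q hq
  exact ⟨fun _ => X, T, S, e, ι, hS, hdeg, hrho, hop, hz, hinj, hran, hιact, hact, hspl⟩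

/-- **IUTchII:Def4.9(vii)** (kurims p.158) NON-VACUITY WITH GENUINE GALOIS SIDE of abc-iut-L6-t2's record type of
`F^{⊢▶×μ}`-prime-strips: `FSplitTriMuPrimeStrip (badOnly l) (fun _ => Π_k) X` is inhabited — by the underlying
`F^{⊢▶×μ}`-prime-strip (`toSplitStripFunctor`, Def 4.9 (viii)) of the genuine-Galois strip of `exists_galois` — for
group-theoretic units `X` that ARE `𝒪_k̄^× ⊆ k̄` with `Π_k` acting through `ε_k` (injection `ι`), open subgroups of
`Π_k`, `Im(Ẑ^×) := 1`. Upgrades `FSplitTriMuPrimeStrip.nonempty_degenerate` (p418814, `G = Unit`).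
[cite: Mochizuki2012, Def 4.9 (vii) p.158] -/
theorem _root_.Literature.IUT.HodgeArakelov.FSplitTriMuPrimeStrip.nonempty_galois (l : ℕ) :
    ∃ (X : Unit → GroupTheoreticUnits.{0, 0} D.Pi) (ι : (X ()).OxG →* K),
      (X ()).openSubgroups = {H : Subgroup D.Pi | IsOpen (H : Set D.Pi)} ∧ (X ()).zhatUnits = ⊥ ∧
      Function.Injective ι ∧ Set.range ι = ↑(unitSubmonoid k K) ∧
      (∀ (g : D.Pi) (u : (X ()).OxG), ι ((X ()).act g u) = D.aug g • ι u) ∧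
      Nonempty (FSplitTriMuPrimeStrip.{0, 0, 0} (Witness.badOnly l) (fun _ => D.Pi) X) := by
  obtain ⟨X, -, S, -, ι, -, -, -, hop, hz, hinj, hran, hιact, -, -⟩ := exists_galois D l
  exact ⟨X, ι, hop, hz, hinj, hran, hιact, ⟨toSplitStripFunctor.obj S⟩⟩

/-- **IUTchII:Def4.9(vii)** (kurims p.157) NON-VACUITY WITH GENUINE GALOIS SIDE of the record type of
`F^{⊢×μ}`-prime-strips: `FTimesMuPrimeStrip (badOnly l) (fun _ => Π_k) X` is inhabited — by «passing to `F^{⊢×μ}`»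
(`FSplitTriMuPrimeStrip.toTimesMuFunctor`) from the previous witness; same genuine `X`. Upgrades
`FTimesMuPrimeStrip.nonempty_degenerate` (p418814). [cite: Mochizuki2012, Def 4.9 (vii) p.157] -/
theorem _root_.Literature.IUT.HodgeArakelov.FTimesMuPrimeStrip.nonempty_galois (l : ℕ) :
    ∃ (X : Unit → GroupTheoreticUnits.{0, 0} D.Pi) (ι : (X ()).OxG →* K),
      (X ()).openSubgroups = {H : Subgroup D.Pi | IsOpen (H : Set D.Pi)} ∧ (X ()).zhatUnits = ⊥ ∧
      Function.Injective ι ∧ Set.range ι = ↑(unitSubmonoid k K) ∧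
      (∀ (g : D.Pi) (u : (X ()).OxG), ι ((X ()).act g u) = D.aug g • ι u) ∧
      Nonempty (FTimesMuPrimeStrip.{0, 0, 0} (Witness.badOnly l) (fun _ => D.Pi) X) := by
  obtain ⟨X, -, S, -, ι, -, -, -, hop, hz, hinj, hran, hιact, -, -⟩ := exists_galois D l
  exact ⟨X, ι, hop, hz, hinj, hran, hιact,
    ⟨FSplitTriMuPrimeStrip.toTimesMuFunctor.obj (toSplitStripFunctor.obj S)⟩⟩

/-- **IUTchII:Def4.9(vi)** (kurims p.157) NON-VACUITY WITH GENUINE GALOIS SIDE of the field-only record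
`FTriMuPrimeStrip` (the `V`-indexed collection of Def 4.9 (vi) local data), whose local datum at the one place IS the
genuine-Galois `‡F^{⊢▶×μ}_w` (`Π_k ↷ 𝒪_k̄^× × q^ℕ` through `ε_k`, read through `e`). Upgrades
`FTriMuPrimeStrip.nonempty_degenerate` (p418814). [cite: Mochizuki2012, Def 4.9 (vi) p.157] -/
theorem _root_.Literature.IUT.HodgeArakelov.FTriMuPrimeStrip.nonempty_galois (l : ℕ) :
    ∃ (X : Unit → GroupTheoreticUnits.{0, 0} D.Pi) (T : NonarchTriMuDatum.{0, 0, 0} l PlaceKind.bad D.Pi (X ()))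
      (F : FTriMuPrimeStrip.{0, 0, 0} (Witness.badOnly l) (fun _ => D.Pi) X)
      (e : (T.O : Type) ≃* ↥(unitSubmonoid k K) × Multiplicative ℕ),
      F.localDatum () = LocalTriMuDatum.bad T ∧
      (∀ (g : D.Pi) (x : T.O), e (T.act g x) = (g • (e x).1, (e x).2)) ∧
      (∀ x : T.O, x ∈ T.splitting ↔ (e x).1 = 1) := by
  obtain ⟨X, T, S, e, -, hS, -, -, -, -, -, -, -, hact, hspl⟩ := exists_galois D l
  exact ⟨X, T, (toSplitStripFunctor.obj S).data, e, hS, hact, hspl⟩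

/-- **IUTchIII:Thm2.2(i)** (kurims p.65) «the second arrows in each line are surjections», NON-VACUOUSLY AT A
GENUINE-GALOIS STRIP: for the strip of `exists_galois` (`‡G = Π_k ↷ 𝒪_k̄^× × q^ℕ`), `Aut_{F^{⊩▶×μ}}(S) → Aut_{F^{⊢×μ}}(S)`
is surjective (instance of abc-iut-w4-d028's `mapAut_toTimesMu_surjective`, p415182). [claim: Mochizuki2012, status: disputed] -/
theorem mapAut_toTimesMu_surjective_galois (l : ℕ) :
    ∃ (X : Unit → GroupTheoreticUnits.{0, 0} D.Pi) (ι : (X ()).OxG →* K)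
      (S : FVdashSplitTriMuPrimeStrip.{0, 0, 0} (Witness.badOnly l) (fun _ => D.Pi) X),
      Function.Injective ι ∧ Set.range ι = ↑(unitSubmonoid k K) ∧
      (∀ (g : D.Pi) (u : (X ()).OxG), ι ((X ()).act g u) = D.aug g • ι u) ∧
      Function.Surjective ((toSplitStripFunctor ⋙ FSplitTriMuPrimeStrip.toTimesMuFunctor).mapAut S) := by
  obtain ⟨X, -, S, -, ι, -, -, -, -, -, hinj, hran, hιact, -, -⟩ := exists_galois D l
  exact ⟨X, ι, S, hinj, hran, hιact, mapAut_toTimesMu_surjective S⟩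

/-- **IUTchII:Def4.9(viii)** (kurims p.158) CLOSED INSTANCE (no free parameters, for the census): over `ℚ_p`
(`MLFClosure.padic p`) with `‡G := Gal(ℚ̄_p/ℚ_p)` ITSELF (`ModelMLFGaloisData.galois`, `ε = id`), for every `l` the
groupoid of `F^{⊩▶×μ}`-prime-strips over `(fun _ => Gal(ℚ̄_p/ℚ_p))` and the three record types `FSplitTriMuPrimeStrip`,
`FTimesMuPrimeStrip`, `FTriMuPrimeStrip` are inhabited, the group-theoretic units being `𝒪_{ℚ̄_p}^× ⊆ ℚ̄_p` with the
tautological Galois action `ι(σ · u) = σ(ι u)`. [cite: Mochizuki2012, Def 4.9 (viii) p.158] -/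
theorem nonempty_galois_padic (p : ℕ) [Fact p.Prime] (l : ℕ) :
    ∃ (X : Unit → GroupTheoreticUnits.{0, 0}
        (ModelMLFGaloisData.galois (MLFClosure.padic p).k (MLFClosure.padic p).K).Pi)
      (ι : (X ()).OxG →* (MLFClosure.padic p).K),
      Function.Injective ι ∧ Set.range ι = ↑(unitSubmonoid (MLFClosure.padic p).k (MLFClosure.padic p).K) ∧
      (∀ (σ : (MLFClosure.padic p).K ≃ₐ[(MLFClosure.padic p).k] (MLFClosure.padic p).K) (u : (X ()).OxG),
        ι ((X ()).act σ u) = σ (ι u)) ∧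
      Nonempty (FVdashSplitTriMuPrimeStrip.{0, 0, 0} (Witness.badOnly l) (fun _ => _) X) ∧
      Nonempty (FSplitTriMuPrimeStrip.{0, 0, 0} (Witness.badOnly l) (fun _ => _) X) ∧
      Nonempty (FTimesMuPrimeStrip.{0, 0, 0} (Witness.badOnly l) (fun _ => _) X) ∧
      Nonempty (FTriMuPrimeStrip.{0, 0, 0} (Witness.badOnly l) (fun _ => _) X) := by
  obtain ⟨X, -, S, -, ι, -, -, -, -, -, hinj, hran, hιact, -, -⟩ :=
    exists_galois (ModelMLFGaloisData.galois (MLFClosure.padic p).k (MLFClosure.padic p).K) l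
  exact ⟨X, ι, hinj, hran, fun σ u => hιact σ u, ⟨S⟩, ⟨toSplitStripFunctor.obj S⟩,
    ⟨FSplitTriMuPrimeStrip.toTimesMuFunctor.obj (toSplitStripFunctor.obj S)⟩, ⟨(toSplitStripFunctor.obj S).data⟩⟩

end GaloisWitness

end FVdashSplitTriMuPrimeStrip

end Literature.IUT.HodgeArakelov
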